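import Summits.BirchSwinnertonDyer.Rank1Residual.Additive.SpecialJTraceForm1728
import HarnessLib

/-!
# `j = 0` over `𝔽_p`: the trace is `C((p−1)/2, (p−1)/3)·(−c₆/864)^{(p−1)/6}` modulo `p`

HONEST FRAMING (cell `b2b-bsdres`, run/shared/lean/b2b/bsd-rank1-residual/, verbatim in every
file): the goal of the cell is to DELETE the COMBINATION-SHAPED residual classes of the
Birch–Swinnerton-Dyer formula for ALL analytic-rank `≤ 1` elliptic curves over `ℚ` — "full BSD
formula for every rank `≤ 1` curve in class `C`" assembled STRICTLY from published theorems — so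
that the rank-`≤ 1` remainder becomes exactly the CONSTRUCTION-SHAPED classes, which are TYPED
(missing-input `Prop`s), NOT attempted. This is not "finishing BSD". Sub-cell `additive-p2`
(X3♯(G-ord) / X4♯(G-ord)), generation 35, part 5: research route; no claim beyond the stated
classes; theorems only, no definition, no named fact, nothing booked, no label moved.

## What is proved

The `j = 0` twin of part 4 (`SpecialJTraceCongruence1728`): the Hasse-invariant congruence in the
curve's own invariant `c₆` (gen 3's Euler criterion `intCast_trace_eq_neg_sum_pow` +
`sum_pow_cubic_of_a₄_eq_zero` on the short model `y² = x³ + a₆`, `a₆ = −c₆/864`, transported to an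
arbitrary model: `c₆` changes by `u⁻⁶` and `(u⁻⁶)^{(p−1)/6} = u^{−(p−1)} = 1` in a field with `p`
elements):

* **`SpecialJ.intCast_trace_eq_choose_mul_pow_of_j_eq_zero`** — `E` elliptic over a field `k` with a
  prime number `p ≥ 5`, `p ≡ 1 (mod 3)` of elements, `j(E) = 0`:
  **`p + 1 − #E(k) ≡ C((p−1)/2, (p−1)/3) · (−c₆(E)/864)^{(p−1)/6}` in `k`** (Silverman *AEC* V.4.1(a)).
  With gen 34's trace law `a² + 3m² = 4p` and `a ≡ 1` on anomalous curves, the ANOMALOUS BIT of a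
  `j̃ = 0` reduction at a capable prime (`4p = 3m² + 1`: `7, 19, 37, …`) is ONE sextic residue of
  `c₆(Ẽ)`: e.g. over `𝔽_7`, `a ≡ 3·(−c₆/864) = −c₆` and the six traces `{±1, ±4, ±5}` are pairwise
  incongruent, so anomalous ⟺ `c₆(Ẽ) = −1` in `𝔽_7` (evidence LAW 7 of gen 35's reading on the 261
  defect-`3`/`6` census rows at `7` and the 12 at `19`).

References: C. F. Gauss, *Disquisitiones* §358; K. Ireland, M. Rosen, GTM 84, Ch. 18 §3;
J. H. Silverman, *AEC* V.4.1(a), Ex. V.4.4; L. C. Washington, *Elliptic Curves* §4.6.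
-/

noncomputable section

open scoped Classical

open WeierstrassCurve Literature.NumberTheory.EllipticCurves

namespace Summit.BirchSwinnertonDyer.Rank1Residual.Additive

namespace SpecialJ

variable {k : Type*} [Field k] [Finite k] (E : WeierstrassCurve k) [E.IsElliptic] {p : ℕ}

/-- **The trace of a `j = 0` curve over `𝔽_p` modulo `p`, in terms of `c₆`.** For an elliptic curve
`E` over a field `k` with a prime number `p ≥ 5`, `p ≡ 1 (mod 3)` of elements and `j(E) = 0`:
`p + 1 − #E(k) = C((p−1)/2, (p−1)/3)·(−c₆(E)/864)^{(p−1)/6}` in `k`. On the short model `y² = x³ + a₆`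
(`a₆ = −c₆/864`) this is Euler's criterion applied to `Σ_x (x³ + a₆)^{(p−1)/2}` (only the monomial
`x^{p−1}` survives; gen 3's `sum_pow_cubic_of_a₄_eq_zero`); `(−c₆/864)^{(p−1)/6}` is a model
invariant because `c₆ ↦ u⁻⁶c₆` and `u^{p−1} = 1`. Silverman *AEC* V.4.1(a) (`a ≡` Hasse invariant);
Gauss (Ireland–Rosen Ch. 18 §3). [cite: IrelandRosen1990, Ch. 18 §3, Theorem 4] -/
theorem intCast_trace_eq_choose_mul_pow_of_j_eq_zero (hp : p.Prime) (hp5 : 5 ≤ p)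
    (h3 : 3 ∣ p - 1) (hcard : Nat.card k = p) (hj : E.j = 0) :
    (((p : ℤ) + 1 - Nat.card E.toAffine.Point : ℤ) : k) =
      ((((p - 1) / 2).choose ((p - 1) / 3) : ℕ) : k) * (-E.c₆ / 864) ^ ((p - 1) / 6) := by
  haveI := Fintype.ofFinite k
  haveI : Fact p.Prime := ⟨hp⟩
  obtain ⟨hchar, hq⟩ := ringChar_eq_of_natCard_eq (k := k) hp hcard
  have hp2 : p % 2 = 1 := hp.eq_two_or_odd.resolve_left (by omega)
  obtain ⟨h2, h3'⟩ := ringChar_ne_two_and_ne_three (F := k) hchar hp5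
  obtain ⟨h2', h3''⟩ := two_ne_zero_and_three_ne_zero h2 h3'
  haveI : Invertible (2 : k) := invertibleOfNonzero h2'
  haveI : Invertible (3 : k) := invertibleOfNonzero h3''
  set C := E.toShortNF with hC
  haveI : (C • E).IsShortNF := E.toShortNF_spec
  have hjS : (C • E).j = 0 := by rw [variableChange_j, hj]
  have hc4 : (C • E).c₄ = 0 := (j_eq_zero_iff _).mp hjS
  have h864 : (864 : k) ≠ 0 := by
    rw [show (864 : k) = 2 ^ 5 * 3 ^ 3 by norm_num]
    exact mul_ne_zero (pow_ne_zero _ h2') (pow_ne_zero _ h3'')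
  have ha4 : (C • E).a₄ = 0 := by
    rw [(C • E).c₄_of_isShortNF] at hc4
    have h48 : (-48 : k) ≠ 0 := by
      rw [show (-48 : k) = -(2 ^ 4 * 3) by norm_num]
      exact neg_ne_zero.mpr (mul_ne_zero (pow_ne_zero _ h2') h3'')
    exact (mul_eq_zero.mp hc4).resolve_left h48
  -- Euler's criterion on the short model
  have hdiv2 : Fintype.card k / 2 = (p - 1) / 2 := by rw [hq]; omega
  have hdiv3 : (Fintype.card k - 1) / 3 = (p - 1) / 3 := by rw [hq]
  have hexp : (p - 1) / 2 - (p - 1) / 3 = (p - 1) / 6 := by omega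
  have htr : ((((Fintype.card k : ℤ) + 1 - Nat.card (C • E).toAffine.Point : ℤ)) : k) =
      ((((p - 1) / 2).choose ((p - 1) / 3) : ℕ) : k) * (C • E).a₆ ^ ((p - 1) / 6) := by
    rw [intCast_trace_eq_neg_sum_pow (C • E) h2,
      sum_pow_cubic_of_a₄_eq_zero (C • E) h2 ha4 (by rw [hq]; exact h3), neg_neg, hdiv2, hdiv3,
      hexp]
  -- `a₆ = -c₆/864` on the short model, `c₆(C • E) = u⁻⁶ c₆(E)`, and `u^{p-1} = 1`
  have ha6 : (C • E).a₆ = -(C • E).c₆ / 864 := by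
    rw [(C • E).c₆_of_isShortNF]; field_simp
  have hw : ((C.u⁻¹ : kˣ) : k) ^ (p - 1) = 1 := by
    have h := FiniteField.pow_card_sub_one_eq_one ((C.u⁻¹ : kˣ) : k) (Units.ne_zero _)
    rwa [hq] at h
  have h6 : 6 * ((p - 1) / 6) = p - 1 := by omega
  have hpow : (C • E).a₆ ^ ((p - 1) / 6) = (-E.c₆ / 864) ^ ((p - 1) / 6) := by
    rw [ha6, variableChange_c₆,
      show -(((C.u⁻¹ : kˣ) : k) ^ 6 * E.c₆) / 864 = ((C.u⁻¹ : kˣ) : k) ^ 6 * (-E.c₆ / 864) by ring,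
      mul_pow, ← pow_mul, h6, hw, one_mul]
  rw [Nat.card_congr (VariableChange.pointEquiv E C).toEquiv, ← hpow, ← htr, hq]

end SpecialJ

end Summit.BirchSwinnertonDyer.Rank1Residual.Additive

end
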